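import Mathlib.Geometry.Manifold.ContMDiff.NormedSpace
import Mathlib.Geometry.Manifold.ContMDiff.Constructions
import HarnessLib

/-!
# Smoothness on iterated products of model vector spaces

Topic `Literature/Topology/FourManifolds` (manifold plumbing used by the smooth-families files
`SphereDiffeoLoops.lean`, `SphereFamilyFrames.lean`). For normed spaces `E, F, G, V`, a map
`E × (F × G) → V` is `C^n` in the vector-space sense iff it is `C^n` for the *iterated product*
model with corners `𝓘(E) × (𝓘(F) × 𝓘(G))` (the charted-space structure carried by a product of
manifolds, as opposed to the self-model structure of the normed space `E × (F × G)`; the two are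
propositionally but not definitionally equal, cf. Mathlib's `chartedSpaceSelf_prod`, so a direct
bridge is needed whenever a two-parameter family `ℝ × ℝ × M → …` on a manifold `M` is assembled
from formulas in the model space). All extended charts being identities, both directions are
`contMDiff_iff` / `contMDiffAt_iff` unfolded.

Everything here is proved; no definitions, no named facts.
-/

open scoped Manifold ContDiff Topology
open Function Set Filter

noncomputable section

namespace Literature.Topology.FourManifolds

section Bridge

variable {E F G V : Type*} [NormedAddCommGroup E] [NormedSpace ℝ E] [NormedAddCommGroup F]
  [NormedSpace ℝ F] [NormedAddCommGroup G] [NormedSpace ℝ G] [NormedAddCommGroup V] [NormedSpace ℝ V]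

/-- A `C^n` map on the normed space `E × (F × G)` is `C^n` for the iterated product model with
corners `𝓘(E) × (𝓘(F) × 𝓘(G))` (all extended charts are identities). [folklore] -/
theorem contMDiff_nested_of_contDiff {n : WithTop ℕ∞} {f : E × (F × G) → V} (hf : ContDiff ℝ n f) :
    ContMDiff (𝓘(ℝ, E).prod (𝓘(ℝ, F).prod 𝓘(ℝ, G))) 𝓘(ℝ, V) n f := by
  rw [contMDiff_iff]
  refine ⟨hf.continuous, fun x y => ?_⟩
  simp only [mfld_simps]
  exact hf.contDiffOn.congr (fun p _ => rfl)

/-- Converse of `contMDiff_nested_of_contDiff`, pointwise. [folklore] -/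
theorem contDiffAt_of_contMDiffAt_nested {n : WithTop ℕ∞} {f : E × (F × G) → V} {q : E × (F × G)}
    (hf : ContMDiffAt (𝓘(ℝ, E).prod (𝓘(ℝ, F).prod 𝓘(ℝ, G))) 𝓘(ℝ, V) n f q) : ContDiffAt ℝ n f q := by
  rw [contMDiffAt_iff] at hf
  have h := hf.2
  simp only [mfld_simps] at h
  have hmem : range (Prod.map (@id E) (Prod.map (@id F) (@id G))) ∈ 𝓝 q := by
    rw [Prod.map_id, Prod.map_id, range_id]; exact Filter.univ_mem
  have h2 : ContDiffWithinAt ℝ n f (range (Prod.map (@id E) (Prod.map (@id F) (@id G)))) q :=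
    h.congr (fun y _ => rfl) rfl
  exact h2.contDiffAt hmem

/-- Converse of `contMDiff_nested_of_contDiff`. [folklore] -/
theorem contDiff_of_contMDiff_nested {n : WithTop ℕ∞} {f : E × (F × G) → V}
    (hf : ContMDiff (𝓘(ℝ, E).prod (𝓘(ℝ, F).prod 𝓘(ℝ, G))) 𝓘(ℝ, V) n f) : ContDiff ℝ n f :=
  contDiff_iff_contDiffAt.2 fun q => contDiffAt_of_contMDiffAt_nested (hf q)

end Bridge

end Literature.Topology.FourManifolds
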